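import Summits.ABC.IUTFork.Cor312PilotIdelesPrContentLower
import Summits.ABC.IUTFork.Cor312LicenceShallowMultiSlot
import HarnessLib

/-!
# [IUTchIII] Cor. 3.12 — the (xi-f) inclusion `q-region ⊆ ⁿ˚𝒰_{i+1,p}` at the print-normalised SHARP real setting from the
# EXACT CONTENT of the Θ-boxes, at ANY prime (wild ramification, `p = 2`, `p = l` included): the INHABITED half, set level

PROOF-ONLY support file (D-0012; 0 definitions, 0 `Prop` facts) of the abc-iut cell (WAVE-4 prover seat abc-iut-w4-d092, gen 10;
D-0079 RESCUE sub-cell R-W «WINDOW Θ-SIDE INEQUALITY», lane U, claim «W:U2-HULL-CONTENT-INCLUSION», HOME/STATUS 2026-08-26T15:39Z).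
TAKES NO SIDE on [IUTchIII] Cor. 3.12 (S. Mochizuki, *Inter-universal Teichmüller theory III*, kurims manuscript, Cor. 3.12 p. 173
l. 41 – p. 174 l. 19; proof p. 174 l. 50 – p. 175 l. 1 «the holomorphic hull of the union of the possible images»; Step (xi) (xi-f)
p. 184 l. 26–29; Thm. 3.11 (i) (Ind1), (Ind2) p. 154) or on any author: every statement is about OUR typed objects —
abc-iut-c312-7's packet-normalised sharp real setting `Thm311.Real.settingPrVolSharp` (SHARP Dupuy–Hilado Θ-boxes
`ι_a(t_{Θ,i+1,v_a})·(R_I)^∼`, `q`-boxes `ι_{i+1}(t_{q,v_{i+1}})·(R_I)^∼`, [DupuyHilado2025] §3.9), abc-iut-c312-5's real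
Dupuy–Hilado log-shells `Real.logShellsDH` with (Ind2) = ALL bicontinuous lattice automorphisms of `I_v` (§4.9), and abc-iut-c312-1's
typing of (Ind1)/(Ind2) acting independently on every (capsule slot, place).

THE SET-LEVEL TWIN OF abc-iut-s2-p7's VOLUME IDENTITY. `Cor312PilotIdelesPrContentLower` (p452341) pins the local Θ-VOLUME at
`settingPrVolSharp` to the content-hull sum for the EXACT content family `m(v⃗)` of the slot unions `⋃_a ι_a(t_{Θ,i+1,v_a})·(R_I)^∼`
(binders `hm0`/`hm1`, verbatim below). THIS file reads the same two inputs — abc-iut-s2-p9's exact-content WITNESS in the union of the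
possible images (`Cor312Vol.exists_mem_sUnion_possibleImages_exact_content_of_sharpBox`, through (Ind1)) and the FULLNESS of Ism
(`exists_indGroup_comparison_eq_congr_presAt`: every factorwise family of shell-preserving `ℚ_p`-linear automorphisms is an
indeterminacy) — at the level of SETS, for the INCLUSION that branch C's hull-level clause `Cor312Vol.PilotKummerCompatHull`
and abc-iut-c312-1's `Thm311ToCor312.Licence` are made of:

* §1 `Cor312Vol.exists_mem_sUnion_possibleImages_norm_dEquiv_ge` (generic: any setting over any `p`-adic presentation, any
  label, any summand `v⃗`): from an exact-content witness `x` (content `p^m` at `v⃗`) and fullness, for EVERY family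
  `z_a ∈ log_p(𝒪^×_{v_a})` and EVERY field factor `J` of the summand, SOME possible image `u` has
  `‖ψ_J(u_{v⃗})‖ ≥ ‖p‖^m·Π_a ‖z_a‖`. Mechanism: the `ℤ`-span of the FACTORWISE (Ind2)-orbit of `x_{v⃗}` is `p^m·log_p(R_{v⃗}^×)`
  (Literature `smul_logPacket_subset_closure_factorwiseOrbit`, abc-iut-s2-p9 / Weil *BNT* II §2 Th. 1: `span_ℤ{⊗_a g_a} ⊇
  ⊗_a End_{ℤ_p}`, no transitivity), which contains the pure tensor `p^m·⊗_a z_a` of `J`-coordinate norm `‖p‖^m·Π‖z_a‖`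
  (abc-iut-w5-d216 `NonIsometryMover.norm_dEquiv_purePacket`); a strict norm ball in one coordinate is an additive subgroup
  (ultrametric), so not every orbit element can lie strictly below that norm.
* §2 **`Thm311.Real.qRegion_subset_thetaHull_settingPrVolSharp_of_content`** — at `settingPrVolSharp X hlog …` (ANY pilot data
  `X` over any number field, Θ-ideles `t`, `q`-ideles `tq`), prime `p`, label `i+1 ∈ 𝔽_l^⋇`, exact content family `m(v⃗)`:
  IF at every tuple `v⃗` some `z_{v⃗,a} ∈ log_p(𝒪^×_{v⃗ a})` satisfy **`‖t_{q,v⃗(last)}‖ ≤ ‖p‖^{m(v⃗)}·Π_a ‖z_{v⃗,a}‖`**, THEN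
  `q-region (i+1, p) ⊆ ⁿ˚𝒰_{i+1,p}` — by §1 at every field factor `(v⃗, J)` and abc-iut-w5-d236's frame lemma
  `HullFrame.preimage_hullSet_subset_hull_ofComparison` (p437725; NO `HullDefined` input). With `z` a family of MAXIMAL norm
  `ν_x = max ‖log_p u‖` (abc-iut-w4-d026's `IsMaxOn` binders, p450586) the hypothesis reads `‖t_{q,v⃗(last)}‖ ≤ ‖p‖^{m(v⃗)}·Π_a ν_{v⃗ a}`.
* §3 `licence_settingPrVolSharp_of_content` (abc-iut-c312-1's licence, labels of `𝔽_l^⋇`) and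
  `exists_qPinned_and_hull_settingPrVolSharp_of_content` (branch C's «∃ ρ qK, QPinned ∧ PilotKummerCompatHull», any columns, integral
  `t_q` for the label `0`).

READING (neutral; numbers, not adjectives). The refuted companions read the SAME integer: abc-iut-w4-d026's
`not_qRegion_subset_thetaHull_settingDHVolSharp_of_diag_isMaxOn` (p450586) refutes the inclusion once the diagonal box lies in
`c₀·I_{x⃗₀}` with `‖c₀‖·‖(2p)^{−(i+2)}‖·ν_{x₀}^{i+2} < ‖t_{q,x₀}‖` — and `c₀·I_{x⃗₀} = (c₀(2p)^{−(i+2)})·log_p(R^×)`, so for the exact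
content `p^{m(x⃗₀)}` of the diagonal box the two legs meet with NO gap at the diagonal summand: `‖t_{q,x₀}‖ ≤ ‖p‖^{m}·ν_{x₀}^{i+2}`
inhabited (this file), `>` refuted (p450586). The remaining datum per summand is ONE integer `m(v⃗)` (abc-iut-w4-d026's «tensor level
L», HOME/STATUS 14:37:25Z (b)); abc-iut-c312-5's «T2-EXACT-CONTENT» supplies it in closed form (inner radii and differents), and
`ν` is abc-iut-s2-p12's / the table's column `rho_out`. Tame sanity: `m = ⌊(m_Θ−1)/e⌋·` … recovers abc-iut-w5-d180's exact tame window.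
HONEST SCOPE: OUR sharp containers (Θ-regions constant in `m`), Dupuy–Hilado's typed (Ind1)/(Ind2); the hull-level inclusion is a
STRONGER-THAN-PRINT reading (ADJUDICATION-SPEC §2 (G1′)); nothing here bears on the printed GLOBAL inequality; nothing asserts or
refutes [IUTchIII] Cor. 3.12. [cite: Mochizuki2012, IUTchIII Cor. 3.12 p. 173–175, Thm. 3.11 (i) p. 154, Step (xi) p. 184]
[cite: Mochizuki2012, IUTchIV Prop. 1.2 p. 10, Prop. 1.4 (i) p. 13] [cite: DupuyHilado2025, §3.9, §4.7, §4.9, §4.12]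
[cite: WeilBNT1967, Ch. II §2, Th. 1–2] [claim: Mochizuki2012, status: disputed] for every IUT sentence quoted.
typed ≠ proved; instantiated ≠ endorsed; refuted-as-typed ≠ refuted-in-print.
-/

noncomputable section

open Set Function
open scoped Pointwise

/-! ## §1. Generic: one possible image reaches the norm `‖p‖^m·Π‖z_a‖` at every field factor of an exact-content summand -/

namespace Summit.ABC.IUTFork.Cor312Vol

open Thm311 Cor312 Literature.IUT.LogThetaLattice Literature.IUT.LogVolume

section Setting

variable {T : ThetaIndex} {S : Situation T} {P : Cor312.Setting S} {vQ : T.VQ} {p : ℕ} [hp : Fact p.Prime]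
  (Pr : PadicPresentation S.L vQ p)

/-- **ONE POSSIBLE IMAGE REACHES `‖p‖^m·Π_a ‖z_a‖` AT EVERY FIELD FACTOR.** Let the union of the possible images at `(j, v_ℚ)` contain
a vector `x` whose `v⃗`-component has content EXACTLY `p^m` (`hwit`), and let every factorwise family of shell-preserving `ℚ_p`-linear
automorphisms of the `K_{v⃗ a}` be realised on the summand `v⃗` by the indeterminacy group (`hism`). Then for every family
`z_a ∈ log_p(𝒪^×_{v⃗ a})` and every field factor `J` of `ψ_{v⃗}`, some `u` in the union of the possible images has
`‖p^m‖·Π_a ‖z_a‖ ≤ ‖ψ_{v⃗}(u_{v⃗})_J‖`: the `ℤ`-span of the factorwise orbit of `x_{v⃗}` — all inside the projected union — is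
`p^m·log_p(R_{v⃗}^×) ∋ p^m·⊗_a z_a`, and `{y : ‖ψ_J(y)‖ < r}` is an additive subgroup.
[cite: WeilBNT1967, Ch. II §2, Th. 1] [cite: Mochizuki2012, IUTchIII Thm. 3.11 (i) (Ind2) p. 154] [cite: DupuyHilado2025, §4.9, §4.12] -/
theorem exists_mem_sUnion_possibleImages_norm_dEquiv_ge (j : T.Label) (e : T.Caps j → T.Fibre vQ) (m : ℤ)
    (hwit : ∃ x ∈ ⋃₀ P.possibleImages j vQ,
      Pr.comparison j x e ∈ ((p : ℚ_[p]) ^ m) • (logPacket p (Pr.kk e) : Set (Pr.X e)) ∧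
      Pr.comparison j x e ∉ ((p : ℚ_[p]) ^ (m + 1)) • (logPacket p (Pr.kk e) : Set (Pr.X e)))
    (hism : ∀ g' : ∀ a, Pr.kk e a ≃ₗ[ℚ_[p]] Pr.kk e a,
      (∀ a, g' a '' logUnits (Pr.kk e a) = logUnits (Pr.kk e a)) →
      ∃ Φ ∈ Cor312.Setting.indGroup S, ∀ x, Pr.comparison j (Φ j vQ x) e =
        (PiTensorProduct.congr g' : Pr.X e ≃ₗ[ℚ_[p]] Pr.X e) (Pr.comparison j x e))
    (z : ∀ a, Pr.kk e a) (hz : ∀ a, z a ∈ logUnits (Pr.kk e a)) (J : DIdx p (Pr.kk e)) :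
    ∃ u ∈ ⋃₀ P.possibleImages j vQ,
      ‖((p : ℚ_[p]) ^ m)‖ * ∏ a, ‖z a‖ ≤ ‖dEquiv p (Pr.kk e) (Pr.comparison j u e) J‖ := by
  classical
  haveI : Nonempty (T.Caps j) := ⟨0⟩
  obtain ⟨x, hxU, hxm, hxm1⟩ := hwit
  set r : ℝ := ‖((p : ℚ_[p]) ^ m)‖ * ∏ a, ‖z a‖ with hr
  -- trivial when the target norm vanishes
  by_cases hr0 : r ≤ 0
  · exact ⟨x, hxU, hr0.trans (norm_nonneg _)⟩
  rw [not_le] at hr0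
  -- the projected union and its stability under the factorwise (Ind2)
  set M : Set (Pr.X e) := (fun x => Pr.comparison j x e) '' ⋃₀ P.possibleImages j vQ with hM
  have hstab : ∀ g' : ∀ a, Pr.kk e a ≃ₗ[ℚ_[p]] Pr.kk e a, (∀ a, g' a '' logUnits (Pr.kk e a) = logUnits (Pr.kk e a)) →
      (PiTensorProduct.congr g' : Pr.X e ≃ₗ[ℚ_[p]] Pr.X e) '' M ⊆ M := by
    intro g' hg'
    obtain ⟨Φ, hΦ, hΦe⟩ := hism g' hg'
    rintro _ ⟨_, ⟨x, hx, rfl⟩, rfl⟩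
    obtain ⟨V, ⟨Φ₀, hΦ₀, rfl⟩, ⟨y, hy, rfl⟩⟩ := Set.mem_sUnion.mp hx
    refine ⟨Φ j vQ (Φ₀ j vQ y), ?_, hΦe _⟩
    exact Set.mem_sUnion.mpr ⟨(Φ * Φ₀) j vQ '' P.thetaRegion3 j vQ,
      ⟨Φ * Φ₀, (Cor312.Setting.indGroup S).mul_mem hΦ hΦ₀, rfl⟩, ⟨y, hy, rfl⟩⟩
  -- the `ℤ`-span of the factorwise orbit of `x_{v⃗}` is `p^m·log_p(R_{v⃗}^×)` …
  have hA := smul_logPacket_subset_closure_factorwiseOrbit p (Pr.kk e) (M := M) (Set.mem_image_of_mem _ hxU) hxm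
    (zpow_content p (Pr.kk e) hxm hxm1).2
  -- … and lies inside the `ℤ`-span of `M` itself
  have hcl : AddSubgroup.closure (⋃ g' ∈ {g' : ∀ a, Pr.kk e a ≃ₗ[ℚ_[p]] Pr.kk e a |
        ∀ a, g' a '' logUnits (Pr.kk e a) = logUnits (Pr.kk e a)},
      (PiTensorProduct.congr g' : Pr.X e ≃ₗ[ℚ_[p]] Pr.X e) '' M) ≤ AddSubgroup.closure M :=
    AddSubgroup.closure_mono (Set.iUnion₂_subset fun g' hg' => hstab g' hg')
  -- the pure tensor `p^m·⊗ z_a`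
  have hw : ((p : ℚ_[p]) ^ m) • purePacket p (Pr.kk e) z ∈ AddSubgroup.closure M :=
    hcl (hA (Set.smul_mem_smul_set (purePacket_mem_logPacket_of_mem p (Pr.kk e) hz)))
  have hnorm : ‖dEquiv p (Pr.kk e) (((p : ℚ_[p]) ^ m) • purePacket p (Pr.kk e) z) J‖ = r := by
    rw [map_smul, Pi.smul_apply, norm_smul, Thm311.Real.NonIsometryMover.norm_dEquiv_purePacket]
  -- if every possible image were strictly below `r` at `(v⃗, J)`, so would be the whole `ℤ`-span of `M`
  by_contra hcon
  push Not at hcon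
  let B : AddSubgroup (Pr.X e) :=
    { carrier := {y | ‖dEquiv p (Pr.kk e) y J‖ < r}
      zero_mem' := by
        show ‖dEquiv p (Pr.kk e) 0 J‖ < r
        rw [map_zero, Pi.zero_apply, norm_zero]
        exact hr0
      add_mem' := by
        intro a b ha hb
        show ‖dEquiv p (Pr.kk e) (a + b) J‖ < r
        rw [map_add, Pi.add_apply]
        exact (IsUltrametricDist.norm_add_le_max _ _).trans_lt (max_lt ha hb)
      neg_mem' := by
        intro a ha
        show ‖dEquiv p (Pr.kk e) (-a) J‖ < r
        rw [map_neg, Pi.neg_apply, norm_neg]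
        exact ha }
  have hMB : M ⊆ (B : Set (Pr.X e)) := by
    rintro _ ⟨u, hu, rfl⟩
    exact hcon u hu
  have hwB : ((p : ℚ_[p]) ^ m) • purePacket p (Pr.kk e) z ∈ B := (AddSubgroup.closure_le B).2 hMB hw
  have hlt : ‖dEquiv p (Pr.kk e) (((p : ℚ_[p]) ^ m) • purePacket p (Pr.kk e) z) J‖ < r := hwB
  rw [hnorm] at hlt
  exact lt_irrefl r hlt

end Setting

end Summit.ABC.IUTFork.Cor312Vol

/-! ## §2. At `settingPrVolSharp`: the inclusion from exact contents and radii -/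

namespace Summit.ABC.IUTFork.Thm311.Real

open Cor312 Cor312.Setting Cor312Vol Literature.IUT.LogThetaLattice Literature.IUT.LogVolume
open Literature.NumberTheory.NumberFields

variable {F : Type} [Field F] [NumberField F] (X : PilotData F) {logv : PadicLogs F} (hlog : LogvAnalytic logv)
  (M : Type) [Field M] [NumberField M]
  (archPk : ∀ (j : (thetaIndex X).Label) (vQ : (thetaIndex X).VQ), Set ((logShellsDH X logv).Packet j vQ))
  (archSub : ∀ (j : (thetaIndex X).Label) (v : (thetaIndex X).V),
    Set ((logShellsDH X logv).Packet j ((thetaIndex X).over v)))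
  (Ψ : ℤ → ∀ v : (thetaIndex X).V, v ∈ (thetaIndex X).Vbad → Set ((logShellsDH X logv).StarPacket v))
  (act : ℤ → ∀ v : (thetaIndex X).V, v ∈ (thetaIndex X).Vbad →
    (logShellsDH X logv).StarPacket v → Module.End ℚ ((logShellsDH X logv).StarPacket v))
  (Mmod : ℤ → ∀ j : (thetaIndex X).LabelStar, Set ((logShellsDH X logv).GlobalPacket j.1))
  (region : ℤ → ∀ j : (thetaIndex X).LabelStar, FinDivisor M → ∀ vQ : (thetaIndex X).VQ,
    Set ((logShellsDH X logv).Packet j.1 vQ))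
  (n : ℤ) {HT : Type} {LogLink : HT → HT → Type} {IsFull : ∀ {s t : HT}, LogLink s t → Prop}
  (lat : LGPGaussianLogThetaLattice LogLink IsFull)
  {Frd : Type} {IsoF : Frd → Frd → Type} {Ob : Frd → Type} {realify : Frd → Frd} {Strip : Type}
  {IsoS : Strip → Strip → Type} {Mv : ∀ v : (thetaIndex X).V, v ∈ (thetaIndex X).Vbad → Type}
  [∀ v h, Monoid (Mv v h)]
  (sig : GlobalLGPFrobenioidSignature (thetaIndex X).lstar (thetaIndex X).V (· ∈ (thetaIndex X).Vbad)
    Frd IsoF Ob realify Strip IsoS Mv)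
  (split : SplittingMonoids Mv) {ObΔ : Type} {N : ∀ v : (thetaIndex X).V, v ∈ (thetaIndex X).Vbad → Type}
  [∀ v h, Monoid (N v h)] (qData : QPilotData ObΔ N)
  (tq : ∀ (pp : Nat.Primes) (x : (thetaIndex X).Fibre (.inr pp)), haveI : Fact (pp : ℕ).Prime := ⟨pp.2⟩; kOf X pp.1 x)
  (t : ∀ (pp : Nat.Primes) (_ : Fin X.lstar) (x : (thetaIndex X).Fibre (.inr pp)),
    haveI : Fact (pp : ℕ).Prime := ⟨pp.2⟩; kOf X pp.1 x)
  (htq0 : ∀ pp x, tq pp x ≠ 0)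
  (htq1 : ∀ (pp : Nat.Primes) (x : (thetaIndex X).Fibre (.inr pp)),
    haveI : Fact (pp : ℕ).Prime := ⟨pp.2⟩; placeOf X pp.1 x ∉ X.S → ‖tq pp x‖ = 1)
  (col : ℤ → Column (logShellsDH X logv))

/-- **q-REGION ⊆ Θ-HULL AT `(i+1, p)` FROM THE EXACT CONTENT OF THE Θ-BOXES — ANY PRIME, ANY RAMIFICATION.** At abc-iut-c312-7's
sharp setting `settingPrVolSharp`, let `m(v⃗)` be the EXACT content exponent of the slot union `⋃_a ι_a(t_{Θ,i+1,v_a})·(R_I)^∼` at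
every tuple `v⃗` over `p` (`hm0`: inside `p^{m(v⃗)}·log_p(R_{v⃗}^×)`; `hm1`: not inside `p^{m(v⃗)+1}·log_p(R_{v⃗}^×)`). If at every
tuple some `z_{v⃗,a} ∈ log_p(𝒪^×_{v⃗ a})` have `‖t_{q,v⃗(last)}‖ ≤ ‖p^{m(v⃗)}‖·Π_a ‖z_{v⃗,a}‖`, then the `q`-pilot region at
`(i+1, p)` lies in `ⁿ˚𝒰_{i+1,p}`, the holomorphic hull of the union of the possible images of the Θ-region.
[cite: Mochizuki2012, IUTchIII Cor. 3.12 p. 174–175, Thm. 3.11 (i) p. 154] [cite: DupuyHilado2025, §3.9, §4.9, §4.12]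
[cite: WeilBNT1967, Ch. II §2, Th. 1] [claim: Mochizuki2012, status: disputed] -/
theorem qRegion_subset_thetaHull_settingPrVolSharp_of_content (i : Fin (thetaIndex X).lstar) (pp : Nat.Primes)
    (m : ((thetaIndex X).Caps (labelSucc i) → (thetaIndex X).Fibre (.inr pp)) → ℤ)
    (hm0 : ∀ e : (thetaIndex X).Caps (labelSucc i) → (thetaIndex X).Fibre (.inr pp),
      haveI : Fact (pp : ℕ).Prime := ⟨pp.2⟩
      (⋃ a, iota pp.1 ((presAt X hlog pp).kk e) a (t pp i (e a)) •
          (normalizedPacket pp.1 ((presAt X hlog pp).kk e) : Set ((presAt X hlog pp).X e))) ⊆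
        (((pp : ℕ) : ℚ_[pp]) ^ m e) • (logPacket pp.1 ((presAt X hlog pp).kk e) : Set ((presAt X hlog pp).X e)))
    (hm1 : ∀ e : (thetaIndex X).Caps (labelSucc i) → (thetaIndex X).Fibre (.inr pp),
      haveI : Fact (pp : ℕ).Prime := ⟨pp.2⟩
      ¬ (⋃ a, iota pp.1 ((presAt X hlog pp).kk e) a (t pp i (e a)) •
          (normalizedPacket pp.1 ((presAt X hlog pp).kk e) : Set ((presAt X hlog pp).X e))) ⊆
        (((pp : ℕ) : ℚ_[pp]) ^ (m e + 1)) • (logPacket pp.1 ((presAt X hlog pp).kk e) : Set ((presAt X hlog pp).X e)))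
    (hrad : ∀ e : (thetaIndex X).Caps (labelSucc i) → (thetaIndex X).Fibre (.inr pp),
      haveI : Fact (pp : ℕ).Prime := ⟨pp.2⟩
      ∃ z : ∀ a, (presAt X hlog pp).kk e a, (∀ a, z a ∈ logUnits ((presAt X hlog pp).kk e a)) ∧
        ‖tq pp (e (Fin.last _))‖ ≤ ‖(((pp : ℕ) : ℚ_[pp]) ^ m e)‖ * ∏ a, ‖z a‖) :
    (settingPrVolSharp X hlog M archPk archSub Ψ act Mmod region n lat sig split qData tq t htq0 htq1).qRegion
        (labelSucc i) (.inr pp) ⊆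
      (settingPrVolSharp X hlog M archPk archSub Ψ act Mmod region n lat sig split qData tq t htq0 htq1).thetaHull
        (labelSucc i) (.inr pp) := by
  haveI : Fact (pp : ℕ).Prime := ⟨pp.2⟩
  set P := settingPrVolSharp X hlog M archPk archSub Ψ act Mmod region n lat sig split qData tq t htq0 htq1 with hP
  show factorMapDH X hlog (labelSucc i) (.inr pp) ⁻¹'
      hullSet (factorFieldDH X hlog (labelSucc i) (.inr pp)) (qCentreDH X hlog tq (labelSucc i) (.inr pp)) ⊆
    (HullFrame.ofComparison (factorFieldDH X hlog (labelSucc i) (.inr pp)) (factorMapDH X hlog (labelSucc i) (.inr pp))).hull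
      (⋃₀ P.possibleImages (labelSucc i) (.inr pp))
  refine HullFrame.preimage_hullSet_subset_hull_ofComparison (factorFieldDH X hlog (labelSucc i) (.inr pp))
    (factorMapDH X hlog (labelSucc i) (.inr pp)) _ _ ?_
  rintro ⟨e, J⟩
  obtain ⟨z, hz, hle⟩ := hrad e
  obtain ⟨u, hu, hge⟩ := Cor312Vol.exists_mem_sUnion_possibleImages_norm_dEquiv_ge
    (S := situationPrVol X hlog M archPk archSub Ψ act Mmod region) (P := P) (presAtPr X hlog pp) (labelSucc i) e (m e)
    (Cor312Vol.exists_mem_sUnion_possibleImages_exact_content_of_sharpBox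
      (S := situationPrVol X hlog M archPk archSub Ψ act Mmod region) (P := P) (presAtPr X hlog pp) (t pp) i
      (thetaRegion3_settingPrVolSharp_eq_preimage_pi_sharpBox X hlog M archPk archSub Ψ act Mmod region n lat sig split qData
        t tq htq0 htq1 (labelSucc i) pp) e (m e) (hm0 e) (hm1 e))
    (fun g' hg' => exists_indGroup_comparison_eq_congr_presAt X hlog M archPk archSub Ψ act Mmod region
      (labelSucc i) pp e g' hg')
    z hz J
  refine ⟨u, hu, ?_⟩
  show ‖dEquiv pp.1 ((presAt X hlog pp).kk e)
        (iota pp.1 ((presAt X hlog pp).kk e) (Fin.last _) (tq pp (e (Fin.last _)))) J‖ ≤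
      ‖dEquiv pp.1 ((presAt X hlog pp).kk e) ((presAt X hlog pp).comparison (labelSucc i) u e) J‖
  rw [norm_dEquiv_iota]
  exact hle.trans hge

/-! ## §3. The licence and branch C's hull-level antecedent from exact contents -/

/-- **THE (xi-f) LICENCE AT `settingPrVolSharp` FROM EXACT CONTENTS** (any places, any ramification): with exact content
exponents `m_{p,i}(v⃗)` of the slot unions at every prime `p` and label `i+1` and radii `‖t_{q,v⃗(last)}‖ ≤ ‖p^{m(v⃗)}‖·Π_a ‖z_{v⃗,a}‖`
(`z_{v⃗,a} ∈ log_p(𝒪^×_{v⃗ a})`) at every tuple, abc-iut-c312-1's `Thm311ToCor312.Licence` holds at abc-iut-c312-7's sharp setting.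
[cite: Mochizuki2012, IUTchIII Cor. 3.12 p. 174–175, Step (xi) p. 184] [cite: DupuyHilado2025, §3.9, §4.9, §4.12]
[claim: Mochizuki2012, status: disputed] -/
theorem licence_settingPrVolSharp_of_content
    (m : ∀ (pp : Nat.Primes) (i : Fin (thetaIndex X).lstar),
      ((thetaIndex X).Caps (labelSucc i) → (thetaIndex X).Fibre (.inr pp)) → ℤ)
    (hm0 : ∀ (pp : Nat.Primes) (i : Fin (thetaIndex X).lstar)
      (e : (thetaIndex X).Caps (labelSucc i) → (thetaIndex X).Fibre (.inr pp)),
      haveI : Fact (pp : ℕ).Prime := ⟨pp.2⟩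
      (⋃ a, iota pp.1 ((presAt X hlog pp).kk e) a (t pp i (e a)) •
          (normalizedPacket pp.1 ((presAt X hlog pp).kk e) : Set ((presAt X hlog pp).X e))) ⊆
        (((pp : ℕ) : ℚ_[pp]) ^ m pp i e) • (logPacket pp.1 ((presAt X hlog pp).kk e) : Set ((presAt X hlog pp).X e)))
    (hm1 : ∀ (pp : Nat.Primes) (i : Fin (thetaIndex X).lstar)
      (e : (thetaIndex X).Caps (labelSucc i) → (thetaIndex X).Fibre (.inr pp)),
      haveI : Fact (pp : ℕ).Prime := ⟨pp.2⟩
      ¬ (⋃ a, iota pp.1 ((presAt X hlog pp).kk e) a (t pp i (e a)) •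
          (normalizedPacket pp.1 ((presAt X hlog pp).kk e) : Set ((presAt X hlog pp).X e))) ⊆
        (((pp : ℕ) : ℚ_[pp]) ^ (m pp i e + 1)) • (logPacket pp.1 ((presAt X hlog pp).kk e) : Set ((presAt X hlog pp).X e)))
    (hrad : ∀ (pp : Nat.Primes) (i : Fin (thetaIndex X).lstar)
      (e : (thetaIndex X).Caps (labelSucc i) → (thetaIndex X).Fibre (.inr pp)),
      haveI : Fact (pp : ℕ).Prime := ⟨pp.2⟩
      ∃ z : ∀ a, (presAt X hlog pp).kk e a, (∀ a, z a ∈ logUnits ((presAt X hlog pp).kk e a)) ∧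
        ‖tq pp (e (Fin.last _))‖ ≤ ‖(((pp : ℕ) : ℚ_[pp]) ^ m pp i e)‖ * ∏ a, ‖z a‖) :
    Thm311ToCor312.Licence (settingPrVolSharp X hlog M archPk archSub Ψ act Mmod region n lat sig split qData tq t htq0 htq1) := by
  intro i vQ
  cases vQ with
  | inl u =>
    exact qRegion_subset_thetaHull_settingDHVolSharp_inl X hlog M archPk archSub Ψ act Mmod region n lat sig split qData tq t
      htq0 htq1 (labelSucc i) u
  | inr pp =>
    exact qRegion_subset_thetaHull_settingPrVolSharp_of_content X hlog M archPk archSub Ψ act Mmod region n lat sig split qData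
      tq t htq0 htq1 i pp (m pp i) (hm0 pp i) (hm1 pp i) (hrad pp i)

/-- **BRANCH C's HULL-LEVEL ANTECEDENT «∃ ρ qK, QPinned ∧ PilotKummerCompatHull» AT `settingPrVolSharp` FROM EXACT CONTENTS** (any
columns `col`; integral `q`-ideles for the label `0`, where the Θ-idele is `1` and the identity is a mover; C-cert-1
`Conditional.Antecedent.exists_qPinned_and_hull_iff`). [cite: Mochizuki2012, IUTchIII Cor. 3.12 p. 174–175, Step (xi) p. 184]
[cite: DupuyHilado2025, §3.9, §4.9, §4.12] [claim: Mochizuki2012, status: disputed] -/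
theorem exists_qPinned_and_hull_settingPrVolSharp_of_content (htqle : ∀ pp x, ‖tq pp x‖ ≤ 1)
    (m : ∀ (pp : Nat.Primes) (i : Fin (thetaIndex X).lstar),
      ((thetaIndex X).Caps (labelSucc i) → (thetaIndex X).Fibre (.inr pp)) → ℤ)
    (hm0 : ∀ (pp : Nat.Primes) (i : Fin (thetaIndex X).lstar)
      (e : (thetaIndex X).Caps (labelSucc i) → (thetaIndex X).Fibre (.inr pp)),
      haveI : Fact (pp : ℕ).Prime := ⟨pp.2⟩
      (⋃ a, iota pp.1 ((presAt X hlog pp).kk e) a (t pp i (e a)) •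
          (normalizedPacket pp.1 ((presAt X hlog pp).kk e) : Set ((presAt X hlog pp).X e))) ⊆
        (((pp : ℕ) : ℚ_[pp]) ^ m pp i e) • (logPacket pp.1 ((presAt X hlog pp).kk e) : Set ((presAt X hlog pp).X e)))
    (hm1 : ∀ (pp : Nat.Primes) (i : Fin (thetaIndex X).lstar)
      (e : (thetaIndex X).Caps (labelSucc i) → (thetaIndex X).Fibre (.inr pp)),
      haveI : Fact (pp : ℕ).Prime := ⟨pp.2⟩
      ¬ (⋃ a, iota pp.1 ((presAt X hlog pp).kk e) a (t pp i (e a)) •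
          (normalizedPacket pp.1 ((presAt X hlog pp).kk e) : Set ((presAt X hlog pp).X e))) ⊆
        (((pp : ℕ) : ℚ_[pp]) ^ (m pp i e + 1)) • (logPacket pp.1 ((presAt X hlog pp).kk e) : Set ((presAt X hlog pp).X e)))
    (hrad : ∀ (pp : Nat.Primes) (i : Fin (thetaIndex X).lstar)
      (e : (thetaIndex X).Caps (labelSucc i) → (thetaIndex X).Fibre (.inr pp)),
      haveI : Fact (pp : ℕ).Prime := ⟨pp.2⟩
      ∃ z : ∀ a, (presAt X hlog pp).kk e a, (∀ a, z a ∈ logUnits ((presAt X hlog pp).kk e a)) ∧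
        ‖tq pp (e (Fin.last _))‖ ≤ ‖(((pp : ℕ) : ℚ_[pp]) ^ m pp i e)‖ * ∏ a, ‖z a‖) :
    ∃ (ρ : (∀ v : (thetaIndex X).V, v ∈ (thetaIndex X).Vbad → Set ((logShellsDH X logv).StarPacket v)) →
          ∀ (j : (thetaIndex X).Label) (vQ : (thetaIndex X).VQ), Set ((logShellsDH X logv).Packet j vQ))
        (qK : ∀ v : (thetaIndex X).V, v ∈ (thetaIndex X).Vbad → Set ((logShellsDH X logv).StarPacket v)),
        QPinned ({ toSituation := situationPrVol X hlog M archPk archSub Ψ act Mmod region, col := col } :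
            LatticeSituation (thetaIndex X))
          (settingPrVolSharp X hlog M archPk archSub Ψ act Mmod region n lat sig split qData tq t htq0 htq1) ρ qK ∧
        PilotKummerCompatHull ({ toSituation := situationPrVol X hlog M archPk archSub Ψ act Mmod region, col := col } :
            LatticeSituation (thetaIndex X))
          (settingPrVolSharp X hlog M archPk archSub Ψ act Mmod region n lat sig split qData tq t htq0 htq1) ρ qK := by
  refine (Conditional.Antecedent.exists_qPinned_and_hull_iff
    ({ toSituation := situationPrVol X hlog M archPk archSub Ψ act Mmod region, col := col } : LatticeSituation (thetaIndex X))
    (settingPrVolSharp X hlog M archPk archSub Ψ act Mmod region n lat sig split qData tq t htq0 htq1)).2 fun j vQ => ?_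
  by_cases hj : 0 < (j : ℕ)
  · -- a label of `𝔽_l^⋇`: the content theorem (finite places) / the trivial archimedean container
    have hj' : j = labelSucc ⟨(j : ℕ) - 1, by have := j.2; simp only [thetaIndex] at this ⊢; omega⟩ := by
      ext; simp only [labelSucc, Fin.val_succ]; omega
    rw [hj']
    cases vQ with
    | inl u =>
      exact qRegion_subset_thetaHull_settingDHVolSharp_inl X hlog M archPk archSub Ψ act Mmod region n lat sig split qData tq t
        htq0 htq1 _ u
    | inr pp =>
      exact qRegion_subset_thetaHull_settingPrVolSharp_of_content X hlog M archPk archSub Ψ act Mmod region n lat sig split qData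
        tq t htq0 htq1 _ pp (m pp _) (hm0 pp _) (hm1 pp _) (hrad pp _)
  · -- the label `0`: Θ-idele `1`, identity mover for integral `t_q`
    refine qRegion_subset_thetaHull_settingDHVolSharp_of_movers X hlog M archPk archSub Ψ act Mmod region n lat sig split qData
      tq t htq0 htq1 j vQ fun pp x => exists_mover_of_norm_le X hlog tq t pp j x ?_
    haveI : Fact (pp : ℕ).Prime := ⟨pp.2⟩
    unfold labelIdele
    rw [dif_neg hj, norm_one]
    exact htqle pp x

end Summit.ABC.IUTFork.Thm311.Real

end
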